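import Literature.IUT.HodgeTheaters.PiAvatarNFKitSlots
import Literature.IUT.HodgeTheaters.PiAvatarLocalAmbientNF
import HarnessLib

/-!
# The NF-kit slot `labPull` at the genuine data ([IUTchI] Ex 4.5 (i)(ii)): the isomorphism of `𝔽_l^⋇`-torsors
# `LabCusp(†𝒟^⊚) ⥲ LabCusp(†𝒟_v)` induced by a morphism `†𝒟_v → †𝒟^⊚`, place-agnostic over abc-iut-L5-t4's `LocalDatum`,
# with its four `NFKit` laws as THEOREMS (NFKIT-INSTANCE-MAP row NFK-4; small defs + proofs — post-freeze additive D13, not a cone member)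

S. Mochizuki, *Inter-universal Teichmüller theory I*, kurims manuscript (May 2020), Ex 4.5 (i) pp. 107–108 («the arrow `φ^NF_j : 𝔇_j → 𝒟^⊚`
at `v̲` consists of an arrow `φ^NF_{v̲_j} : 𝒟_{v̲_j} → 𝒟^⊚` … induces various outer homomorphisms `π₁(𝒟_{v̲_j}) → π₁(𝒟^⊚)`; thus, by
considering cuspidal inertia groups of `π₁(𝒟^⊚)` whose unique index `l` subgroup is contained in the image of this homomorphism [cf.
Corollary 2.5 when `v̲ ∈ V̲^bad` …], we conclude that these homomorphisms induce a natural isomorphism of `𝔽_l^⋇`-torsors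
`LabCusp(𝒟^⊚) ⥲ LabCusp(𝒟_{v̲_j})`»), (ii) p. 108 («`φ^LC_j([ε]) ↦ j`; `φ^LC_1(j·[ε]) ↦ j` via the natural bijection `LabCusp(𝒟^>) ⥲ 𝔽_l^⋇`
of Proposition 4.2»), Def 4.1 (ii) p. 96 («a canonical element `†η_v ∈ LabCusp(†𝒟_v)`»), (vi) p. 97, Ex 4.3 (ii) p. 99 (`φ^NF_{•,v}`
«the natural morphism … `X→_v → C_v → C_K`»), Def 6.1 (v) p. 158 («a finite étale double covering `𝒟^{⊚±} → 𝒟^⊚`») ([IUTchI] Ex 4.5 (i) p.107)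
[claim: Mochizuki2012, status: disputed] (D-0012 claim key, series status DISPUTED — definitions and kernel theorems over abc-iut-L5-t2's
REAL `InitialThetaData`, abc-iut-L5-t1's `CuspGalois`, abc-iut-L5-t4's binder `hS : D.CuspClassesNormaliserStable` and local datum
`δ : D.LocalDatum CG hS` (p442681: the local group `Π_v̲` with its local arrow law (L1)(L2)); nothing of the series is asserted, no side
is taken on [IUTchIII] Cor. 3.12).

WHY (abc-iut-L5-t3 = single writer of the NF-side kit `PMBaseKit.NFKit`, L5-lead RULINGS #31/#43/#46/#57 (1) «GO L5-t3 NFK-4 labPull»).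
`NFKit K` (KitNFSide) asks, for every kit morphism `f : †𝒟 → †𝒟^⊚ seen at v` from a LOCAL object, an equivalence `labPull f : LabCusp(†𝒟^⊚) ≃
LabCusp(†𝒟)` with the laws `labPull_smul`, `labPull_pre`/`labPull_post` (naturality in isomorphisms of source and target) and `labPull_phiNF_εLab`
(`[ε] ↦ η_v`).  Under the canonical Type-0 readings (`GLabNF := 𝔽_l^⋇` transported by the character `nfIsoChar`, `[ε] := 1` — PiAvatarNFKitSlots;
`LabStar := 𝔽_l^⋇`, `labStarIso := refl`, `η := 1` — Prop 4.2, Def 4.1 (ii)) the slot VALUE is forced: `labPull f` = multiplication by the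
`𝔽_l^⋇`-class of the SLOPE (`actFSlopeHom`, p433875) of the base element `d ∈ N(Π_{X̲_K})` of `f`; on a `φ^NF`-type morphism `a ≫ φ^NF_{•,v̲} ≫ b` this
is `(nfIsoChar b)⁻¹` (`labPullChar_conj`: «multiplication by the inverse character of the target isomorphism part»), consistent because
automorphisms of `𝒟^⊚` lifting to `𝒟_v̲` have trivial character (NFK-5, p439502; here through (L2)).  This file DEFINES that value in the Π-avatar
(design D1 EMBEDDED), place-agnostically over `δ`, and PROVES the four laws from the two fields (L1)(L2) of `δ.law`:
* `slopeStar : N(Π_{X̲_K}) → 𝔽_l^⋇` (slope class; `= toFlStarNF⁻¹` on `N(Π_{C̲_K})`, trivial on `Π_{C̲_K}` and on `N(Π_v̲)` by (L2)); `nfBaseCoset g ∈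
  Π_{C_F}/Π_{C̲_K}` of `g : ℬ(R)⁰ → 𝒟^⊚`; `nfCosetChar` (slope class of a coset of `N(Π_{X̲_K})`, junk `1` elsewhere);
* **the NF twin of (L1) is a THEOREM** (`conj_mem_PiXund_of_conj_mem_PiCund`, `LocalDatum.mem_normalizer_of_conj_le_PiCund`): every morphism
  `ℬ(Π_v̲)⁰ → 𝒟^⊚ = ℬ(Π_{C̲_K})⁰` of the ambient lifts along the double covering `𝒟^{⊚±} → 𝒟^⊚` (`Π_{X̲_K} = Π_{X_F} ∩ Π_{C̲_K}`, `Π_{X_F} ⊴ Π_{C_F}`) and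
  so has its base element in `N(Π_{X̲_K})` by (L1) — no new binder;
* `LocalDatum.phiNFAmb` (`φ^NF_{•,v̲} : xΠ_v̲ ↦ xΠ_{C̲_K}`) with `phiNFAmb_eq : φ^NF = φ^{Θell} ≫ (𝒟^{⊚±} → 𝒟^⊚)` (the `NFKit` law `phiNF_eq`);
* `nfMarkAmb Y : Y ⥲ 𝒟^⊚` — the gen-5 markings `gnfMarking` CORRECTED to be the identity at `𝒟^⊚` (`nfMarkAmb_gnfModel`); the reduced automorphism
  `nfIsoToAut b = ν_Y⁻¹ b ν_{Y′}` has the SAME character `nfIsoChar b` (`toFlStarNF_nfIsoToAut`: conjugation is invisible in `𝔽_l^⋇`);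
* **kit slot `LocalDatum.labPullAmb f := (labPullChar f) · _`** for `f : X ⟶ Y.obj`, `X` an ambient object, `Y : GlobNF` (junk `1` off the isomorphs
  of `𝒟_v̲` — never used: the kit's `labPull` only sees local sources), and the laws **`labPullAmb_smul`**, **`labPullAmb_pre`** (source
  isomorphisms act trivially: (L2)), **`labPullAmb_post`** (`= labPull f ∘ (gLabNFMapSlot b)⁻¹`), **`labPullAmb_phiNFAmb_one`** (`[ε] = 1 ↦ 1 = η_v̲`).
Assembly of `D.nfKit` over abc-iut-L5-t4's base kit is the SEPARATE row «nfKit-assembly» (junction J-NF-1: the kit's `Amb v` must put the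
isomorphs of `𝒟^⊚` in play).  No instance, no notation; typed ≠ proved elsewhere; binder ≠ fact.
-/

noncomputable section

namespace Literature.IUT.HodgeTheaters

open CategoryTheory

universe u v w

/-- (plumbing) `g * a * g⁻¹ = a` in a commutative group. [folklore] -/
private theorem conj_eq_self_comm {G : Type} [CommGroup G] (g a : G) : g * a * g⁻¹ = a := by
  rw [mul_comm g a, mul_assoc, mul_inv_cancel, mul_one]

section NFLabPull

variable {F : Type u} {K : Type v} {Fbar : Type w} [Field F] [NumberField F] [Field K] [NumberField K]
  [Algebra F K] [Field Fbar] [Algebra F Fbar] [Algebra K Fbar]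
  {E : WeierstrassCurve F} [E.IsElliptic] {l : ℕ} {Pb : BadPlacePredicates K}
  (D : InitialThetaData F K Fbar E l Pb) (CG : D.geom.pe.CuspGalois) (hS : D.CuspClassesNormaliserStable)

namespace InitialThetaData

/-! ### Every morphism `ℬ(R)⁰ → 𝒟^⊚` with `R ≤ Π_{X_F}` lifts along the double covering `𝒟^{⊚±} → 𝒟^⊚` -/

/-- **Conjugates of elements of `Π_{X_F}` that land in `Π_{C̲_K}` land in `Π_{X̲_K}`**: `Π_{X̲_K} = Π_{X_F} ∩ Π_{C̲_K}` (abc-iut-L5-t4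
`PiXund_eq_PiX_inf_PiCund`) and `Π_{X_F} ⊴ Π_{C_F}` (`X_F → C_F` is Galois, Def 3.1 (b)) — the NF twin of the local arrow law (L1): a
morphism `ℬ(R)⁰ → 𝒟^⊚ = ℬ(Π_{C̲_K})⁰`, `R ≤ Π_{X̲_K}`, of the Π-ambient factors through `𝒟^{⊚±} = ℬ(Π_{X̲_K})⁰ → 𝒟^⊚` (Ex 4.3 (ii):
`φ^NF_{•,v}` is `X→_v → X_K → C_K`; Def 6.1 (v)). ([IUTchI] Def 6.1 (v) p.158) [claim: Mochizuki2012, status: disputed] -/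
theorem conj_mem_PiXund_of_conj_mem_PiCund {x d : D.PiC} (hx : x ∈ D.geom.PiX) (h : d⁻¹ * x * d ∈ D.PiCund) :
    d⁻¹ * x * d ∈ D.PiXund := by
  have h1 : d⁻¹ * x * d⁻¹⁻¹ ∈ D.geom.PiX := D.geom.PiX_normal.conj_mem x hx d⁻¹
  rw [inv_inv] at h1
  exact D.PiXund_eq_PiX_inf_PiCund ▸ Subgroup.mem_inf.mpr ⟨h1, h⟩

/-- `Π_{X̲_K} ≤ Π_{X_F}`. ([IUTchI] Def 3.1 (d) p.62) [claim: Mochizuki2012, status: disputed] -/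
theorem PiXund_le_PiX : D.PiXund ≤ D.geom.PiX := D.PiXund_eq_PiX_inf_PiCund ▸ inf_le_left

/-! ### NF base cosets of morphisms to `𝒟^⊚` -/

section NFBaseCoset

variable {D}

/-- The NF BASE COSET of a morphism `g : ℬ(R)⁰ → 𝒟^⊚` of the ambient: `fn g (1·R) ∈ Π_{C_F}/Π_{C̲_K}` (it determines `g = (xR ↦ x·d·Π_{C̲_K})`
for any `d` in it; the `𝒟^⊚`-analogue of abc-iut-L5-t4's `baseCoset`). ([IUTchI] Def 4.1 (vi) p.97) [claim: Mochizuki2012, status: disputed] -/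
def nfBaseCoset {R : Subgroup D.PiC} (g : (OrbitCat.of R : D.PiAmbient) ⟶ D.gBaseObj) : D.PiC ⧸ D.PiCund :=
  OrbitCat.fn g (QuotientGroup.mk 1)

/-- The NF base coset of `a ≫ g` for an automorphism `a = (xR ↦ xnR)`: `n • (base coset of g)`. ([IUTchI] Def 4.1 (vi) p.97) [claim: Mochizuki2012, status: disputed] -/
theorem nfBaseCoset_aut_comp {R : Subgroup D.PiC} {n : D.PiC} (hn : n ∈ Subgroup.normalizer ((R : Subgroup D.PiC) : Set D.PiC))
    (g : (OrbitCat.of R : D.PiAmbient) ⟶ D.gBaseObj) :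
    nfBaseCoset ((OrbitCat.autOfNormalizer n hn).hom ≫ g) = n • nfBaseCoset (D := D) g := by
  change OrbitCat.fn g (OrbitCat.fn (OrbitCat.autOfNormalizer n hn).hom (QuotientGroup.mk 1)) = n • OrbitCat.fn g (QuotientGroup.mk 1)
  rw [OrbitCat.fn_autOfNormalizer_hom, one_mul, ← OrbitCat.fn_smul]
  congr 1
  change (QuotientGroup.mk n : D.PiC ⧸ R) = QuotientGroup.mk (n * 1)
  rw [mul_one]

/-- The NF base coset of `g ≫ (xΠ_{C̲_K} ↦ xmΠ_{C̲_K})`: `(base coset of g) · m`. ([IUTchI] Def 4.1 (vi) p.97) [claim: Mochizuki2012, status: disputed] -/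
theorem nfBaseCoset_comp_aut {R : Subgroup D.PiC} {m : D.PiC} (hm : m ∈ Subgroup.normalizer ((D.PiCund : Subgroup D.PiC) : Set D.PiC))
    (g : (OrbitCat.of R : D.PiAmbient) ⟶ D.gBaseObj) {d : D.PiC} (hg : nfBaseCoset g = (QuotientGroup.mk d : D.PiC ⧸ D.PiCund)) :
    nfBaseCoset (g ≫ (OrbitCat.autOfNormalizer m hm).hom) = (QuotientGroup.mk (d * m) : D.PiC ⧸ D.PiCund) := by
  change OrbitCat.fn (OrbitCat.autOfNormalizer m hm).hom (nfBaseCoset g) = _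
  rw [hg]; exact OrbitCat.fn_autOfNormalizer_hom m hm d

end NFBaseCoset

variable [Fact l.Prime]

/-! ### The slope class `N(Π_{X̲_K}) → 𝔽_l^⋇` -/

/-- **The slope class `N_{Π_{C_F}}(Π_{X̲_K}) → 𝔽_l^⋇`**: the linear part of the affine cusp action (`actFSlopeHom`, Def 6.1 (v): the action on
the rank one quotient) modulo `{±1}` — on `N(Π_{C̲_K})` this is abc-iut-L5-t3's `toFlStarNFOnNormalizer` (Ex 4.3 (i) `Aut(C̲_K) → 𝔽_l^⋇`).
([IUTchI] Ex 4.3 (i) p.99) [claim: Mochizuki2012, status: disputed] -/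
def slopeStar : ↥(Subgroup.normalizer ((D.PiXund : Subgroup D.PiC) : Set D.PiC)) →* FlStar l :=
  (QuotientGroup.mk' (unitsPlusMinus l)).comp (D.actFSlopeHom CG hS)

/-- `slopeStar n` is the class of `actFSlopeUnit n`. ([IUTchI] Ex 4.3 (i) p.99) [claim: Mochizuki2012, status: disputed] -/
theorem slopeStar_apply (n : ↥(Subgroup.normalizer ((D.PiXund : Subgroup D.PiC) : Set D.PiC))) :
    D.slopeStar CG hS n = FlStar.mk l (D.actFSlopeUnit CG hS n) := rfl

/-- Elements of `Π_{C̲_K}` have trivial slope class (slope `±1`: `Gal(X̲_K/C̲_K) = {1, ι̲}`). ([IUTchI] Def 6.1 (v) p.158) [claim: Mochizuki2012, status: disputed] -/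
theorem slopeStar_eq_one_of_mem_PiCund (n : ↥(Subgroup.normalizer ((D.PiXund : Subgroup D.PiC) : Set D.PiC)))
    (hn : (n : D.PiC) ∈ D.PiCund) : D.slopeStar CG hS n = 1 := by
  rw [slopeStar_apply, FlStar.mk_eq_one_iff]
  rcases D.actFSlope_eq_one_or_eq_neg_one_of_mem_PiCund CG hS n hn with h | h
  · exact Or.inl (Units.ext h)
  · exact Or.inr (Units.ext h)

/-- **(L2) read on the slope class**: an element acting on the labels by `z ↦ ±z` in the chart at `ε⁰` (the sign law of an automorphism of
`𝒟_v̲`, Def 6.1 (iii)) has trivial slope class. ([IUTchI] Def 6.1 (iii) p.157) [claim: Mochizuki2012, status: disputed] -/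
theorem slopeStar_eq_one_of_sign (n : ↥(Subgroup.normalizer ((D.PiXund : Subgroup D.PiC) : Set D.PiC)))
    (h : ∃ ε : ℤˣ, ∀ x, D.gChart₀Model CG (D.actF CG hS n x) = ε • D.gChart₀Model CG x) : D.slopeStar CG hS n = 1 := by
  obtain ⟨ε, hε⟩ := h
  have hs : D.actFSlope CG hS n = ε • (1 : ZMod l) := by
    change D.gChart₀Model CG (D.actF CG hS n D.geom.pe.ε1) - D.gChart₀Model CG (D.actF CG hS n D.geom.pe.ε0) = _
    rw [hε, hε, D.gChart₀Model_ε1 CG, D.gChart₀Model_ε0 CG, smul_zero, sub_zero]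
  have h1 : D.actFSlope CG hS n = 1 ∨ D.actFSlope CG hS n = -1 := by
    rcases Int.units_eq_one_or ε with rfl | rfl
    · left; rw [hs, one_smul]
    · right; rw [hs, Units.neg_smul, one_smul]
  rw [slopeStar_apply, FlStar.mk_eq_one_iff]
  rcases h1 with h | h
  · exact Or.inl (Units.ext h)
  · exact Or.inr (Units.ext h)

/-! ### The slope class of a coset of `N(Π_{X̲_K})` in `Π_{C_F}/Π_{C̲_K}` -/

open Classical in
/-- **The slope class attached to a coset `q ∈ Π_{C_F}/Π_{C̲_K}`**: `slopeStar m` if `q = mΠ_{C̲_K}` with `m ∈ N(Π_{X̲_K})` (well defined: `Π_{C̲_K}`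
has slope `±1`), `1` otherwise (never used). This is the multiplier on `𝔽_l^⋇`-labels of the morphism `ℬ(R)⁰ → 𝒟^⊚`, `xR ↦ xmΠ_{C̲_K}` (Ex 4.5 (i)).
([IUTchI] Ex 4.5 (i) p.107) [claim: Mochizuki2012, status: disputed] -/
def nfCosetChar (q : D.PiC ⧸ D.PiCund) : FlStar l :=
  if h : ∃ m : ↥(Subgroup.normalizer ((D.PiXund : Subgroup D.PiC) : Set D.PiC)),
      (QuotientGroup.mk (m : D.PiC) : D.PiC ⧸ D.PiCund) = q
  then D.slopeStar CG hS h.choose else 1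

/-- `nfCosetChar (mΠ_{C̲_K}) = slopeStar m` for `m ∈ N(Π_{X̲_K})`. ([IUTchI] Ex 4.5 (i) p.107) [claim: Mochizuki2012, status: disputed] -/
theorem nfCosetChar_mk (m : ↥(Subgroup.normalizer ((D.PiXund : Subgroup D.PiC) : Set D.PiC))) :
    D.nfCosetChar CG hS (QuotientGroup.mk (m : D.PiC)) = D.slopeStar CG hS m := by
  have h : ∃ m' : ↥(Subgroup.normalizer ((D.PiXund : Subgroup D.PiC) : Set D.PiC)),
      (QuotientGroup.mk (m' : D.PiC) : D.PiC ⧸ D.PiCund) = QuotientGroup.mk (m : D.PiC) := ⟨m, rfl⟩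
  rw [nfCosetChar, dif_pos h]
  have hq : ((h.choose : D.PiC))⁻¹ * (m : D.PiC) ∈ D.PiCund := QuotientGroup.eq.mp h.choose_spec
  have h1 : D.slopeStar CG hS (h.choose⁻¹ * m) = 1 := D.slopeStar_eq_one_of_mem_PiCund CG hS _ hq
  rwa [map_mul, map_inv, inv_mul_eq_one] at h1

/-! ### Corrected ambient markings of the isomorphs of `𝒟^⊚` and the reduced automorphism of an isomorphism -/

/-- The ambient isomorphism underlying an isomorphism of isomorphs of `𝒟^⊚` (the inclusion `GlobNF ⥤` ambient is fully faithful).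
([IUTchI] Def 4.1 (v) p.97) [claim: Mochizuki2012, status: disputed] -/
def isoAmb {Y Y' : D.GlobNF} (b : Y ≅ Y') : Y.obj ≅ Y'.obj := (D.IsGlobNFIsomorph).ι.mapIso b

omit [Fact l.Prime] in
/-- `(isoAmb b).hom = b.hom.hom`. ([IUTchI] Def 4.1 (v) p.97) [claim: Mochizuki2012, status: disputed] -/
@[simp] theorem isoAmb_hom {Y Y' : D.GlobNF} (b : Y ≅ Y') : (D.isoAmb b).hom = b.hom.hom := rfl

/-- **The corrected ambient marking `Y ⥲ 𝒟^⊚` of an isomorph `Y` of `𝒟^⊚`**: abc-iut-L5-t3's marking `gnfMarking Y` (inverted) followed by the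
marking of `𝒟^⊚` itself, so that `𝒟^⊚` is marked by the IDENTITY (`nfMarkAmb_gnfModel`). ([IUTchI] Def 4.1 (v) p.97) [claim: Mochizuki2012, status: disputed] -/
def nfMarkAmb (Y : D.GlobNF) : Y.obj ≅ D.gBaseObj := D.isoAmb ((D.gnfMarking Y).symm ≪≫ D.gnfMarking D.gnfModel)

omit [Fact l.Prime] in
/-- The corrected marking of `𝒟^⊚` is the identity. ([IUTchI] Def 4.1 (v) p.97) [claim: Mochizuki2012, status: disputed] -/
theorem nfMarkAmb_gnfModel : D.nfMarkAmb D.gnfModel = Iso.refl _ := by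
  rw [nfMarkAmb, Iso.symm_self_id]
  exact (D.IsGlobNFIsomorph).ι.mapIso_refl _

/-- **The automorphism of `𝒟^⊚` induced by an isomorphism `b : Y ⥲ Y′` of isomorphs through the corrected markings**: `ν_Y⁻¹ ≫ b ≫ ν_{Y′}`.
([IUTchI] Def 4.1 (v) p.97) [claim: Mochizuki2012, status: disputed] -/
def nfIsoToAut {Y Y' : D.GlobNF} (b : Y ≅ Y') : Aut (D.gBaseObj) := (D.nfMarkAmb Y).symm ≪≫ D.isoAmb b ≪≫ D.nfMarkAmb Y'

/-- **Its character is abc-iut-L5-t3's `nfIsoChar b`** — the two marking systems differ by conjugation by ONE automorphism of `𝒟^⊚`, invisible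
in the commutative `𝔽_l^⋇`. ([IUTchI] Ex 4.3 (i) p.99) [claim: Mochizuki2012, status: disputed] -/
theorem toFlStarNF_nfIsoToAut {Y Y' : D.GlobNF} (b : Y ≅ Y') :
    D.toFlStarNF CG hS (D.nfIsoToAut b) = D.nfIsoChar CG hS b := by
  have e : D.nfIsoToAut b = D.autObj (D.gnfMarking D.gnfModel) * D.isoToAut b * (D.autObj (D.gnfMarking D.gnfModel))⁻¹ :=
    Iso.ext rfl
  rw [e, map_mul, map_mul, map_inv]
  exact conj_eq_self_comm (G := FlStar l) _ (D.nfIsoChar CG hS b)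

namespace LocalDatum

variable {D CG hS} (δ : D.LocalDatum CG hS)

/-! ### The NF arrow law of a local datum is a theorem -/

/-- **The NF twin of (L1), a THEOREM**: an element `d ∈ Π_{C_F}` with `d⁻¹ Π_v̲ d ≤ Π_{C̲_K}` — a morphism `ℬ(Π_v̲)⁰ → 𝒟^⊚` of the ambient —
NORMALISES `Π_{X̲_K}` (it conjugates `Π_v̲` into `Π_{X̲_K} = Π_{X_F} ∩ Π_{C̲_K}` as `Π_{X_F} ⊴ Π_{C_F}`, then (L1) of the datum): every morphism
`†𝒟_v̲ → †𝒟^⊚` is `φ^NF_{•,v̲}` up to automorphisms of `𝒟^{⊚±}`-level data. ([IUTchI] Ex 4.3 (ii) p.99) [claim: Mochizuki2012, status: disputed] -/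
theorem mem_normalizer_of_conj_le_PiCund (d : D.PiC) (hd : ∀ x ∈ δ.H, d⁻¹ * x * d ∈ D.PiCund) :
    d ∈ Subgroup.normalizer ((D.PiXund : Subgroup D.PiC) : Set D.PiC) :=
  δ.law.mem_normalizer_of_conj_le d fun x hx =>
    D.conj_mem_PiXund_of_conj_mem_PiCund (D.PiXund_le_PiX ((δ.le_und.trans δ.und_le) hx)) (hd x hx)

/-- **(L1-NF) on morphisms**: a morphism `ℬ(R)⁰ → 𝒟^⊚` from an object with `Π_v̲ ≤ R` has NF base coset `d·Π_{C̲_K}` for some `d ∈ N(Π_{X̲_K})`.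
([IUTchI] Ex 4.3 (ii) p.99) [claim: Mochizuki2012, status: disputed] -/
theorem exists_nfBaseCoset_eq {R : Subgroup D.PiC} (hR : δ.H ≤ R) (g : (OrbitCat.of R : D.PiAmbient) ⟶ D.gBaseObj) :
    ∃ d : ↥(Subgroup.normalizer ((D.PiXund : Subgroup D.PiC) : Set D.PiC)),
      nfBaseCoset g = (QuotientGroup.mk (d : D.PiC) : D.PiC ⧸ D.PiCund) := by
  obtain ⟨d, hd, rfl⟩ := OrbitCat.exists_eq_homOfElem g
  have hdN : d ∈ Subgroup.normalizer ((D.PiXund : Subgroup D.PiC) : Set D.PiC) :=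
    δ.mem_normalizer_of_conj_le_PiCund d fun x hx => hd x (hR hx)
  refine ⟨⟨d, hdN⟩, ?_⟩
  change (QuotientGroup.mk ((1 : D.PiC) * d) : D.PiC ⧸ D.PiCund) = QuotientGroup.mk d
  rw [one_mul]

/-! ### `φ^NF_{•,v̲}` at the datum and its factorisation through the double covering -/

/-- **`φ^NF_{•,v̲} : 𝒟_v̲ → 𝒟^⊚` at the local datum** (Ex 4.3 (ii): «the natural morphism … `X→_v → C_v → C_K`»; the NF-kit slot `phiNF v`):
`xΠ_v̲ ↦ xΠ_{C̲_K}` (at a good place with `Π_v̲ = Π_{X̲→_K} ∩ augGF⁻¹ G_v̲` this is abc-iut-L5-t3's `phiNFAt`). ([IUTchI] Ex 4.3 (ii) p.99) [claim: Mochizuki2012, status: disputed] -/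
def phiNFAmb : δ.locObj ⟶ D.gBaseObj :=
  OrbitCat.homOfElem 1 (OrbitCat.one_conj_mem_of_le δ.H_le_PiCund)

/-- `φ^NF_{•,v̲}` on cosets: `xΠ_v̲ ↦ xΠ_{C̲_K}`. ([IUTchI] Ex 4.3 (ii) p.99) [claim: Mochizuki2012, status: disputed] -/
theorem fn_phiNFAmb (x : D.PiC) : OrbitCat.fn δ.phiNFAmb (QuotientGroup.mk x) = (QuotientGroup.mk x : D.PiC ⧸ D.PiCund) := by
  change (QuotientGroup.mk (x * 1) : D.PiC ⧸ D.PiCund) = QuotientGroup.mk x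
  rw [mul_one]

/-- **The NF-kit law `phiNF_eq` at the datum**: `φ^NF_{•,v̲} = φ^{Θell}_{•,v̲} ≫ (𝒟^{⊚±} → 𝒟^⊚)` (`X̲→_v̲ → X̲_K → C̲_K`).
([IUTchI] Def 6.1 (v) p.158) [claim: Mochizuki2012, status: disputed] -/
theorem phiNFAmb_eq : δ.phiNFAmb = δ.phiEllAmb ≫ D.globCover := by
  apply OrbitCat.hom_ext_fn
  funext q
  induction q using QuotientGroup.induction_on with
  | H x =>
    change (QuotientGroup.mk (x * 1) : D.PiC ⧸ D.PiCund) = QuotientGroup.mk (x * 1 * 1)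
    rw [mul_one, mul_one]

/-- The NF base coset of `φ^NF_{•,v̲}` is the trivial coset. ([IUTchI] Ex 4.3 (ii) p.99) [claim: Mochizuki2012, status: disputed] -/
theorem nfBaseCoset_phiNFAmb : nfBaseCoset δ.phiNFAmb = (QuotientGroup.mk 1 : D.PiC ⧸ D.PiCund) :=
  δ.fn_phiNFAmb 1

/-! ### The slot value and its two core computations -/

/-- **Core computation (pre)**: pre-composing `g : ℬ(Π_v̲)⁰ → 𝒟^⊚` with an automorphism of `𝒟_v̲` does not change the slope class of its
base coset — automorphisms of `𝒟_v̲` act on the labels by `±1` ((L2); Def 4.1 (ii): `†η_v` and the torsor structure are canonical, so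
`Aut(†𝒟_v)` acts trivially on `LabCusp(†𝒟_v)`). ([IUTchI] Def 4.1 (ii) p.96) [claim: Mochizuki2012, status: disputed] -/
theorem nfCosetChar_nfBaseCoset_aut_comp (α : δ.locObj ≅ δ.locObj) (g : δ.locObj ⟶ D.gBaseObj) :
    D.nfCosetChar CG hS (nfBaseCoset (α.hom ≫ g)) = D.nfCosetChar CG hS (nfBaseCoset g) := by
  obtain ⟨n, hn, rfl⟩ := OrbitCat.exists_eq_autOfNormalizer α
  obtain ⟨d, hd⟩ := δ.exists_nfBaseCoset_eq le_rfl g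
  have hnX : n ∈ Subgroup.normalizer ((D.PiXund : Subgroup D.PiC) : Set D.PiC) := δ.law.normalizer_le hn
  rw [nfBaseCoset_aut_comp hn g, hd, MulAction.Quotient.smul_mk, smul_eq_mul,
    show n * (d : D.PiC) = ((⟨n, hnX⟩ * d : ↥(Subgroup.normalizer ((D.PiXund : Subgroup D.PiC) : Set D.PiC))) : D.PiC) from rfl,
    D.nfCosetChar_mk CG hS, D.nfCosetChar_mk CG hS, map_mul, D.slopeStar_eq_one_of_sign CG hS ⟨n, hnX⟩ (δ.law.sign n hn hnX), one_mul]

/-- **Core computation (post)**: post-composing `g : ℬ(Π_v̲)⁰ → 𝒟^⊚` with an automorphism `β` of `𝒟^⊚` multiplies the slope class of its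
base coset by `(toFlStarNF β)⁻¹` (Ex 4.3 (i): `Aut(𝒟^⊚)` moves `LabCusp(𝒟^⊚)` through its character). ([IUTchI] Ex 4.5 (i) p.107) [claim: Mochizuki2012, status: disputed] -/
theorem nfCosetChar_nfBaseCoset_comp_aut (g : δ.locObj ⟶ D.gBaseObj) (β : Aut (D.gBaseObj)) :
    D.nfCosetChar CG hS (nfBaseCoset (g ≫ β.hom)) = D.nfCosetChar CG hS (nfBaseCoset g) * (D.toFlStarNF CG hS β)⁻¹ := by
  obtain ⟨m, hm, rfl⟩ := OrbitCat.exists_eq_autOfNormalizer β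
  obtain ⟨d, hd⟩ := δ.exists_nfBaseCoset_eq le_rfl g
  have hmX : m ∈ Subgroup.normalizer ((D.PiXund : Subgroup D.PiC) : Set D.PiC) := D.normalizer_PiCund_le_normalizer_PiXund hm
  rw [nfBaseCoset_comp_aut hm g hd, hd,
    show (d : D.PiC) * m = ((d * ⟨m, hmX⟩ : ↥(Subgroup.normalizer ((D.PiXund : Subgroup D.PiC) : Set D.PiC))) : D.PiC) from rfl,
    D.nfCosetChar_mk CG hS, D.nfCosetChar_mk CG hS, map_mul, D.toFlStarNF_autOfNormalizer CG hS m hm, inv_inv]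
  rfl

/-- The marking-reduced morphism `μ_X⁻¹ ≫ f ≫ ν_Y : ℬ(Π_v̲)⁰ → 𝒟^⊚` of a morphism `f : X → Y` from an isomorph `X` of `𝒟_v̲` to an isomorph
`Y` of `𝒟^⊚` (abc-iut-L5-t4's markings `locMark`, the corrected NF markings `nfMarkAmb`). ([IUTchI] Def 4.1 (vi) p.97) [claim: Mochizuki2012, status: disputed] -/
def nfReduce {X : D.PiAmbient} (hX : Nonempty (X ≅ δ.locObj)) {Y : D.GlobNF} (f : X ⟶ Y.obj) : δ.locObj ⟶ D.gBaseObj :=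
  (δ.locMark X hX).inv ≫ f ≫ (D.nfMarkAmb Y).hom

/-- Reduction splits at the source marking: `reduce (φ ≫ f) = (μ_{X′}⁻¹ φ μ_X) ≫ reduce f`. ([IUTchI] Def 4.1 (vi) p.97) [claim: Mochizuki2012, status: disputed] -/
theorem nfReduce_iso_comp {X X' : D.PiAmbient} (hX : Nonempty (X ≅ δ.locObj)) (hX' : Nonempty (X' ≅ δ.locObj)) (φ : X' ≅ X)
    {Y : D.GlobNF} (f : X ⟶ Y.obj) :
    δ.nfReduce hX' (φ.hom ≫ f) = ((δ.locMark X' hX').symm ≪≫ φ ≪≫ δ.locMark X hX).hom ≫ δ.nfReduce hX f := by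
  simp only [nfReduce, Iso.trans_hom, Iso.symm_hom, Category.assoc, Iso.hom_inv_id_assoc]

/-- Reduction splits at the target marking: `reduce (f ≫ b) = reduce f ≫ (ν_Y⁻¹ b ν_{Y′})`. ([IUTchI] Def 4.1 (vi) p.97) [claim: Mochizuki2012, status: disputed] -/
theorem nfReduce_comp_iso {X : D.PiAmbient} (hX : Nonempty (X ≅ δ.locObj)) {Y Y' : D.GlobNF} (f : X ⟶ Y.obj) (b : Y ≅ Y') :
    δ.nfReduce hX (f ≫ b.hom.hom) = δ.nfReduce hX f ≫ (D.nfIsoToAut b).hom := by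
  simp only [nfReduce, nfIsoToAut, Iso.trans_hom, Iso.symm_hom, isoAmb_hom, Category.assoc, Iso.hom_inv_id_assoc]

open Classical in
/-- **NF-kit slot `labPull` at the datum, as a character**: for a morphism `f : X → Y` of the ambient from an isomorph `X` of `𝒟_v̲` to an
isomorph `Y` of `𝒟^⊚`, the slope class of the NF base coset of the reduced morphism `ℬ(Π_v̲)⁰ → 𝒟^⊚` — the multiplier by which the induced
bijection `LabCusp(†𝒟^⊚) ⥲ LabCusp(†𝒟_v)` of Ex 4.5 (i) acts on the canonical labels `𝔽_l^⋇` (Prop 4.2); `1` on other sources (never used).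
([IUTchI] Ex 4.5 (i) p.107) [claim: Mochizuki2012, status: disputed] -/
def labPullChar {X : D.PiAmbient} {Y : D.GlobNF} (f : X ⟶ Y.obj) : FlStar l :=
  if hX : Nonempty (X ≅ δ.locObj) then D.nfCosetChar CG hS (nfBaseCoset (δ.nfReduce hX f)) else 1

/-- The local branch of `labPullChar`. ([IUTchI] Ex 4.5 (i) p.107) [claim: Mochizuki2012, status: disputed] -/
theorem labPullChar_of_loc {X : D.PiAmbient} {Y : D.GlobNF} (f : X ⟶ Y.obj) (hX : Nonempty (X ≅ δ.locObj)) :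
    δ.labPullChar f = D.nfCosetChar CG hS (nfBaseCoset (δ.nfReduce hX f)) := by
  rw [labPullChar, dif_pos hX]

/-- The junk branch of `labPullChar` (sources that are not isomorphs of `𝒟_v̲`). ([IUTchI] Ex 4.5 (i) p.107) [claim: Mochizuki2012, status: disputed] -/
theorem labPullChar_of_not {X : D.PiAmbient} {Y : D.GlobNF} (f : X ⟶ Y.obj) (hX : ¬ Nonempty (X ≅ δ.locObj)) :
    δ.labPullChar f = 1 := by
  rw [labPullChar, dif_neg hX]

/-- **NF-kit slot `labPull` at the datum**: `LabCusp(†𝒟^⊚) ⥲ LabCusp(†𝒟_v)` read on the canonical labels `𝔽_l^⋇` of both sides (Prop 4.2,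
Def 4.1 (ii)) — multiplication by `labPullChar f`. ([IUTchI] Ex 4.5 (i) p.107) [claim: Mochizuki2012, status: disputed] -/
def labPullAmb {X : D.PiAmbient} {Y : D.GlobNF} (f : X ⟶ Y.obj) : FlStar l ≃ FlStar l :=
  Equiv.mulLeft (δ.labPullChar f)

/-- `labPullAmb f c = labPullChar f * c`. ([IUTchI] Ex 4.5 (i) p.107) [claim: Mochizuki2012, status: disputed] -/
@[simp] theorem labPullAmb_apply {X : D.PiAmbient} {Y : D.GlobNF} (f : X ⟶ Y.obj) (c : FlStar l) :
    δ.labPullAmb f c = δ.labPullChar f * c := rfl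

/-! ### The four `NFKit` laws -/

/-- **Naturality in isomorphisms of the source, character form**: `labPullChar (φ ≫ f) = labPullChar f` — an isomorphism of isomorphs of
`𝒟_v̲` induces the IDENTITY on canonical labels (`labStarIso := refl`), by (L2). ([IUTchI] Ex 4.5 (i) p.107) [claim: Mochizuki2012, status: disputed] -/
theorem labPullChar_iso_comp {X X' : D.PiAmbient} (hX : Nonempty (X ≅ δ.locObj)) (φ : X' ≅ X) {Y : D.GlobNF} (f : X ⟶ Y.obj) :
    δ.labPullChar (φ.hom ≫ f) = δ.labPullChar f := by
  have hX' : Nonempty (X' ≅ δ.locObj) := ⟨φ ≪≫ hX.some⟩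
  rw [δ.labPullChar_of_loc _ hX', δ.labPullChar_of_loc _ hX, δ.nfReduce_iso_comp hX hX' φ f]
  exact δ.nfCosetChar_nfBaseCoset_aut_comp _ _

/-- **Naturality in isomorphisms of the target, character form**: `labPullChar (f ≫ b) = labPullChar f * (nfIsoChar b)⁻¹`.
([IUTchI] Ex 4.5 (i) p.107) [claim: Mochizuki2012, status: disputed] -/
theorem labPullChar_comp_iso {X : D.PiAmbient} (hX : Nonempty (X ≅ δ.locObj)) {Y Y' : D.GlobNF} (f : X ⟶ Y.obj) (b : Y ≅ Y') :
    δ.labPullChar (f ≫ b.hom.hom) = δ.labPullChar f * (D.nfIsoChar CG hS b)⁻¹ := by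
  rw [δ.labPullChar_of_loc _ hX, δ.labPullChar_of_loc _ hX, δ.nfReduce_comp_iso hX f b, ← D.toFlStarNF_nfIsoToAut CG hS b]
  exact δ.nfCosetChar_nfBaseCoset_comp_aut _ _

/-- **`[ε] ↦ η_v̲`, character form**: `labPullChar (φ^NF_{•,v̲}) = 1`. ([IUTchI] Ex 4.5 (ii) p.108) [claim: Mochizuki2012, status: disputed] -/
theorem labPullChar_phiNFAmb : δ.labPullChar (Y := D.gnfModel) δ.phiNFAmb = 1 := by
  have hX : Nonempty (δ.locObj ≅ δ.locObj) := ⟨Iso.refl _⟩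
  have h : δ.nfReduce hX (Y := D.gnfModel) δ.phiNFAmb = δ.phiNFAmb := by
    rw [nfReduce, δ.locMark_locObj hX, D.nfMarkAmb_gnfModel]
    exact (Category.id_comp _).trans (Category.comp_id _)
  rw [δ.labPullChar_of_loc _ hX, h, δ.nfBaseCoset_phiNFAmb,
    show (QuotientGroup.mk (1 : D.PiC) : D.PiC ⧸ D.PiCund) =
      QuotientGroup.mk (((1 : ↥(Subgroup.normalizer ((D.PiXund : Subgroup D.PiC) : Set D.PiC))) : D.PiC)) from rfl,
    D.nfCosetChar_mk CG hS, map_one]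

/-- **On `φ^NF`-type morphisms `a ≫ φ^NF_{•,v̲} ≫ b` the slot is multiplication by the INVERSE CHARACTER of the target isomorphism part**
(`(nfIsoChar b)⁻¹`; well defined by NFK-5: lifting automorphisms have trivial character). ([IUTchI] Ex 4.5 (i) p.107) [claim: Mochizuki2012, status: disputed] -/
theorem labPullChar_conj {X : D.PiAmbient} (a : X ≅ δ.locObj) {Y : D.GlobNF} (b : D.gnfModel ≅ Y) :
    δ.labPullChar (a.hom ≫ δ.phiNFAmb ≫ b.hom.hom) = (D.nfIsoChar CG hS b)⁻¹ := by
  have h1 := δ.labPullChar_iso_comp ⟨Iso.refl _⟩ a (δ.phiNFAmb ≫ b.hom.hom)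
  have h2 := δ.labPullChar_comp_iso ⟨Iso.refl _⟩ δ.phiNFAmb b
  rw [δ.labPullChar_phiNFAmb, one_mul] at h2
  exact h1.trans h2

/-- **NF-kit law `labPull_smul`** (equivariance). ([IUTchI] Ex 4.5 (i) p.107) [claim: Mochizuki2012, status: disputed] -/
theorem labPullAmb_smul {X : D.PiAmbient} {Y : D.GlobNF} (f : X ⟶ Y.obj) (j c : FlStar l) :
    δ.labPullAmb f (j • c) = j • δ.labPullAmb f c := by
  rw [labPullAmb_apply, labPullAmb_apply, smul_eq_mul, smul_eq_mul]
  exact mul_left_comm (δ.labPullChar f) j c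

/-- **NF-kit law `labPull_pre`** (the local label transport `labStarIso` reads `refl`): `labPull (φ ≫ f) = labPull f` for an isomorphism `φ` of
isomorphs of `𝒟_v̲`. ([IUTchI] Ex 4.5 (i) p.107) [claim: Mochizuki2012, status: disputed] -/
theorem labPullAmb_pre {X X' : D.PiAmbient} (hX : Nonempty (X ≅ δ.locObj)) (φ : X' ≅ X) {Y : D.GlobNF} (f : X ⟶ Y.obj) (c : FlStar l) :
    δ.labPullAmb (φ.hom ≫ f) c = δ.labPullAmb f c := by
  rw [labPullAmb_apply, labPullAmb_apply, δ.labPullChar_iso_comp hX φ f]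

/-- **NF-kit law `labPull_post`** (the global label transport is abc-iut-L5-t3's `gLabNFMapSlot b = (nfIsoChar b) · _`):
`labPull (f ≫ nfAtV b) c = labPull f ((gLabNFMap b)⁻¹ c)`. ([IUTchI] Ex 4.5 (i) p.107) [claim: Mochizuki2012, status: disputed] -/
theorem labPullAmb_post {X : D.PiAmbient} (hX : Nonempty (X ≅ δ.locObj)) {Y Y' : D.GlobNF} (f : X ⟶ Y.obj) (b : Y ≅ Y') (c : FlStar l) :
    δ.labPullAmb (f ≫ (D.nfAtV).map b.hom) c = δ.labPullAmb f ((D.gLabNFMapSlot CG hS b).symm c) := by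
  change δ.labPullChar (f ≫ b.hom.hom) * c = δ.labPullChar f * (Equiv.mulLeft (D.nfIsoChar CG hS b)).symm c
  rw [δ.labPullChar_comp_iso hX f b, Equiv.mulLeft_symm, mul_assoc]
  rfl

/-- **NF-kit law `labPull_phiNF_εLab`** (`[ε] := 1`, `η_v̲ := 1` on the canonical labels): `labPull (φ^NF_{•,v̲}) 1 = 1`.
([IUTchI] Ex 4.5 (ii) p.108) [claim: Mochizuki2012, status: disputed] -/
theorem labPullAmb_phiNFAmb_one : δ.labPullAmb (Y := D.gnfModel) δ.phiNFAmb (1 : FlStar l) = 1 := by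
  rw [labPullAmb_apply, δ.labPullChar_phiNFAmb, one_mul]

end LocalDatum

end InitialThetaData

end NFLabPull

end Literature.IUT.HodgeTheaters
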